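import Summits.Parity.GeneralizedHardyLittlewood.Theorems.LeeYangFibresAbsoluteUpgradeDefs
import Summits.Parity.GeneralizedHardyLittlewood.Theorems.LeeYangFibresAbsoluteUpgradeSinglesDecayDict
import Summits.Parity.GeneralizedHardyLittlewood.Theorems.LeeYangFibresAbsoluteUpgradeSinglesDecaySeq
import HarnessLib

/-!
# Route `LeeYangFibres`, crux `AbsoluteUpgrade` (stmt-Parity-14116), line `nlc-cells-absolute-clip`:
# helper file 8 for the stub `stub_singlesDecay` — preparation of the engine

Book-keeping lemmas for the proof of `SinglesDecay` (the statement `NlcCellsAbsoluteClip.SinglesDecay`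
of the line's Defs file), all about a one-dimensional system `Ψ` at scale `N` and roughness `N^{1/u}`:

* `exists_interval` — the lattice points of `K ∩ {all ψ_k ≥ 1}` (`K ⊆ [-N, N]` convex) form an integer
  interval `[m₁, m₂]` with `#[m₁, m₂] ≤ β_∞(Ψ, K) + 1` (tree: `DimOne.exists_filter_eq_Icc`);
* `roughTuples_sum_eq` — the parity sum of `ψ_i` over the rough tuples `roughTuples Ψ K N u` is the sum
  of `λ(a_i m + b_i)` over the rough points of that interval;
* `roughTuples_eq_empty_of_obstructed` — a prime `p ≤ N^{1/u}` at which every residue is a root of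
  `F_Ψ = ∏_k (a_k X + b_k)` kills all rough tuples;
* `exp_neg_le_exp_neg_div`, `one_div_log_le`, `prod_one_sub_rootCount_le_main` — the numerics of the
  sifting level `z = ⌊N^{1/u}⌋ + 1` and the level `D = N^{1/8}`: `e^{−log D/log z} ≤ e^{−u/16}`,
  `1/log z ≤ u/log N`, and `V(z) ≤ 2 ∏_p β_p · (u/log N)^t` (helper file 3);
* `main_term_le` — the arithmetic of the main term.
-/

noncomputable section

open Finset Polynomial ArithmeticFunction MeasureTheory

namespace Summit.Parity.GeneralizedHardyLittlewood.Theorems.AbsoluteUpgrade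

open Literature.NumberTheory.Sieve
open Summit.Parity.GeneralizedHardyLittlewood.Cruxes.AbsoluteUpgrade.NlcCellsAbsoluteClip

variable {t : ℕ}

/-! ### The interval of lattice points -/

/-- **The positive lattice points of `K` form an interval of length `≤ β_∞ + 1`.** For a convex
`K ⊆ [-N, N]` there are `m₁, m₂` with
`{m ∈ [-N, N] : (m) ∈ K, ψ_k(m) ≥ 1 ∀ k} = [m₁, m₂]` and `#[m₁, m₂] ≤ β_∞(Ψ, K) + 1`.
[cite: GreenTao2010, (1.4) and App. A] -/
theorem exists_interval (Ψ : Fin t → AffLinForm 1) {N : ℕ} {K : Set (Fin 1 → ℝ)} (hK : Convex ℝ K)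
    (hKN : K ⊆ realBox 1 N) :
    ∃ m₁ m₂ : ℤ, (∀ m : ℤ, m ∈ Finset.Icc m₁ m₂ ↔
        (m ∈ Finset.Icc (-(N : ℤ)) N ∧ (fun _ : Fin 1 => (m : ℝ)) ∈ K ∧
          ∀ k, 1 ≤ (Ψ k).eval (fun _ => m))) ∧
      (#(Finset.Icc m₁ m₂) : ℝ) ≤ archFactor Ψ K + 1 := by
  classical
  -- adapted from `Theorems.FibrationFibreSums.abs_card_sub_archFactor_le_one`
  set S : Set ℝ := {r : ℝ | (fun _ : Fin 1 => r) ∈ K ∧ ∀ i, 0 < (Ψ i).realEval (fun _ => r)} with hS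
  have harch : archFactor Ψ K = (volume S).toReal := DimOne.archFactor_eq Ψ K
  have hSconv : Convex ℝ S := by
    have h1 : Convex ℝ {r : ℝ | (fun _ : Fin 1 => r) ∈ K} := DimOne.convex_slice hK
    have h2 : ∀ i, Convex ℝ {r : ℝ | 0 < (Ψ i).realEval (fun _ => r)} := fun i => by
      have : {r : ℝ | 0 < (Ψ i).realEval (fun _ => r)} =
          {r : ℝ | 0 < ((Ψ i).coeff 0 : ℝ) * r + (Ψ i).const} := by
        ext r; simp [DimOne.realEval_eq]
      rw [this]; exact DimOne.convex_setOf_pos _ _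
    have : S = {r : ℝ | (fun _ : Fin 1 => r) ∈ K} ∩ ⋂ i, {r : ℝ | 0 < (Ψ i).realEval (fun _ => r)} := by
      ext r; simp [hS]
    rw [this]
    exact h1.inter (convex_iInter h2)
  have hSN : S ⊆ Set.Icc (-(N : ℝ)) N := by
    intro r hr
    have h := hKN hr.1
    simp only [realBox, Set.mem_Icc, Pi.le_def] at h
    exact ⟨h.1 0, h.2 0⟩
  obtain ⟨m₁, m₂, hI, hvol⟩ := DimOne.exists_filter_eq_Icc (N := N) hSconv.ordConnected hSN
  refine ⟨m₁, m₂, fun m => ?_, ?_⟩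
  · rw [← hI, Finset.mem_filter]
    simp only [hS, Set.mem_setOf_eq]
    have hev : ∀ k, (Ψ k).realEval (fun _ : Fin 1 => (m : ℝ)) = (((Ψ k).eval (fun _ => m) : ℤ) : ℝ) :=
      fun k => (Ψ k).realEval_intCast (fun _ => m)
    simp only [hev]
    constructor
    · rintro ⟨hm, hK', hpos⟩
      exact ⟨hm, hK', fun k => by have := hpos k; exact_mod_cast this⟩
    · rintro ⟨hm, hK', hpos⟩
      exact ⟨hm, hK', fun k => by have := hpos k; exact_mod_cast this⟩
  · rw [harch]
    linarith [(abs_le.mp hvol).2]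

/-! ### The parity sum over the rough tuples -/

/-- Roughness with `N^{1/u} ≥ 2` forces the value to be `≥ 1` (indeed `≥ 2`). [folklore] -/
theorem one_le_of_rough {y : ℝ} (hy : 2 ≤ y) {v : ℤ} (h : y < (Nat.minFac v.toNat : ℝ)) : 1 ≤ v := by
  by_contra hv
  push Not at hv
  rw [Int.toNat_of_nonpos (by omega), Nat.minFac_zero] at h
  push_cast at h
  linarith

/-- **The parity sum over the rough tuples is a Liouville sum over the rough points of the interval.**
[folklore] -/
theorem roughTuples_sum_eq : ∀ {t : ℕ} (Ψ : Fin t → AffLinForm 1) {N u : ℕ}, (2 : ℝ) ≤ (N : ℝ) ^ ((1 : ℝ) / u) → ∀ (K : Set (Fin 1 → ℝ)) (i : Fin t) {m₁ m₂ : ℤ}, (∀ m : ℤ, m ∈ Finset.Icc m₁ m₂ ↔ (m ∈ Finset.Icc (-(N : ℤ)) N ∧ (fun _ : Fin 1 => (m : ℝ)) ∈ K ∧ ∀ k, 1 ≤ (Ψ k).eval (fun _ => m))) → ∑ n ∈ roughTuples Ψ K N u, (-1 : ℝ) ^ (cardFactors ((Ψ i).eval n).toNat) = ∑ m ∈ (Finset.Icc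 m₁ m₂).filter (fun m : ℤ => ∀ k, (N : ℝ) ^ ((1 : ℝ) / u) < (Nat.minFac ((Ψ k).eval (fun _ => m)).toNat : ℝ)), (liouville ((Ψ i).coeff 0 * m + (Ψ i).const).toNat : ℝ) := by
  intro t Ψ N u hN2 K i m₁ m₂ hI
  classical
  unfold roughTuples
  rw [sum_filter_latticeBox]
  have hset : (Finset.Icc (-(N : ℤ)) N).filter (fun m : ℤ => realPoint (fun _ : Fin 1 => m) ∈ K ∧
      ∀ k, (N : ℝ) ^ ((1 : ℝ) / u) < (Nat.minFac ((Ψ k).eval (fun _ => m)).toNat : ℝ)) =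
      (Finset.Icc m₁ m₂).filter (fun m : ℤ => ∀ k, (N : ℝ) ^ ((1 : ℝ) / u) <
          (Nat.minFac ((Ψ k).eval (fun _ => m)).toNat : ℝ)) := by
    ext m
    rw [Finset.mem_filter, Finset.mem_filter, hI, DimOne.realPoint_const]
    constructor
    · rintro ⟨hm, hK', hr⟩
      exact ⟨⟨hm, hK', fun k => one_le_of_rough hN2 (hr k)⟩, hr⟩
    · rintro ⟨⟨hm, hK', -⟩, hr⟩
      exact ⟨hm, hK', hr⟩
  rw [hset]
  refine Finset.sum_congr rfl fun m hm => ?_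
  rw [Finset.mem_filter] at hm
  have h1 := one_le_of_rough hN2 (hm.2 i)
  have hne : ((Ψ i).eval (fun _ => m)).toNat ≠ 0 := by omega
  have hev : (Ψ i).eval (fun _ => m) = (Ψ i).coeff 0 * m + (Ψ i).const := by rw [DimOne.eval_eq]
  rw [hev] at hne
  rw [hev, liouville_apply hne]
  push_cast
  rfl

/-! ### Local obstructions kill the rough tuples -/

/-- If every residue is a root of `F` modulo `p`, then `p ∣ F(n)` for every integer `n`. [folklore] -/
theorem dvd_eval_of_rootCount_eq (F : ℤ[X]) {p : ℕ} (hp : 0 < p)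
    (hρ : polyRootCountMod ![F] p = p) (n : ℤ) : (p : ℤ) ∣ F.eval n := by
  have heq : rootsMod F p = range p := by
    refine Finset.eq_of_subset_of_card_le (Finset.filter_subset _ _) ?_
    rw [card_rootsMod, hρ, Finset.card_range]
  have hp0 : (p : ℤ) ≠ 0 := by exact_mod_cast hp.ne'
  set s := (n % p).toNat with hs
  have hsval : ((s : ℕ) : ℤ) = n % p := Int.toNat_of_nonneg (Int.emod_nonneg n hp0)
  have hsp : s < p := by
    have := Int.emod_lt_of_pos n (by exact_mod_cast hp : (0 : ℤ) < p)
    omega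
  have hsroot : s ∈ rootsMod F p := by rw [heq]; exact Finset.mem_range.mpr hsp
  have hmod : n ≡ (s : ℤ) [ZMOD p] := by
    rw [hsval, Int.ModEq, Int.emod_emod_of_dvd n (dvd_refl (p : ℤ))]
  exact (dvd_eval_iff_of_modEq F hmod).mpr (mem_rootsMod.mp hsroot).2

/-- **A local obstruction below the rough threshold kills all rough tuples**: if `p ≤ N^{1/u}`
(`N^{1/u} ≥ 2`) and every residue is a root of `F_Ψ` modulo `p`, then `roughTuples Ψ K N u = ∅`.
[folklore] -/
theorem roughTuples_eq_empty_of_obstructed (Ψ : Fin t → AffLinForm 1) {N u p : ℕ} (hp : p.Prime)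
    (hρ : polyRootCountMod ![sysPoly Ψ] p = p) (hpN : (p : ℝ) ≤ (N : ℝ) ^ ((1 : ℝ) / u))
    (hN2 : (2 : ℝ) ≤ (N : ℝ) ^ ((1 : ℝ) / u)) (K : Set (Fin 1 → ℝ)) :
    roughTuples Ψ K N u = ∅ := by
  classical
  unfold roughTuples
  refine Finset.filter_eq_empty_iff.mpr fun n _ hn => ?_
  have hp' : Prime (p : ℤ) := Nat.prime_iff_prime_int.mp hp
  have h := dvd_eval_of_rootCount_eq (sysPoly Ψ) hp.pos hρ (n 0)
  rw [sysPoly_eval] at h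
  obtain ⟨k, -, hk⟩ := (hp'.dvd_finsetProd_iff _).mp h
  have hnk : (fun _ : Fin 1 => n 0) = n := funext fun j => by rw [Fin.fin_one_eq_zero j]
  rw [hnk] at hk
  exact RoughTuple.not_rough_of_prime_dvd hp hpN hN2 hk (hn.2 k)

/-! ### Numerics of the sifting level -/

/-- `e^{−log D/log z} ≤ e^{−u/16}` for `D = N^{1/8}` and `1 < z ≤ 2N^{1/u}`, `N^{1/u} ≥ 2`.
[folklore] -/
theorem exp_neg_le_exp_neg_div {N u : ℕ} (hu : 1 ≤ u) (hN2 : (2 : ℝ) ≤ (N : ℝ) ^ ((1 : ℝ) / u))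
    {z : ℝ} (hz1 : 1 < z) (hz : z ≤ 2 * (N : ℝ) ^ ((1 : ℝ) / u)) :
    Real.exp (-(Real.log ((N : ℝ) ^ ((1 : ℝ) / 8)) / Real.log z)) ≤ Real.exp (-((1 : ℝ) / 16 * u)) := by
  have hu0 : (0 : ℝ) < u := by exact_mod_cast hu
  have hN0 : (0 : ℝ) < N := by
    by_contra h
    push Not at h
    have : (N : ℝ) = 0 := le_antisymm h (Nat.cast_nonneg N)
    rw [this, Real.zero_rpow (by positivity)] at hN2
    linarith
  have hlogy : Real.log ((N : ℝ) ^ ((1 : ℝ) / u)) = Real.log N / u := by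
    rw [Real.log_rpow hN0]; ring
  have hlog2 : Real.log 2 ≤ Real.log N / u := by
    rw [← hlogy]; exact Real.log_le_log (by norm_num) hN2
  have hlogN : 0 < Real.log N := by
    have : 0 < Real.log N / u := lt_of_lt_of_le (Real.log_pos one_lt_two) hlog2
    by_contra h; push Not at h
    have : Real.log N / u ≤ 0 := div_nonpos_of_nonpos_of_nonneg h hu0.le
    linarith
  have hlogz : 0 < Real.log z := Real.log_pos hz1
  have hlogz2 : Real.log z ≤ 2 * Real.log N / u := by
    calc Real.log z ≤ Real.log (2 * (N : ℝ) ^ ((1 : ℝ) / u)) := Real.log_le_log (by linarith) hz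
      _ = Real.log 2 + Real.log N / u := by
          rw [Real.log_mul (by norm_num) (by positivity), hlogy]
      _ ≤ 2 * Real.log N / u := by rw [mul_div_assoc]; linarith
  rw [Real.exp_le_exp, neg_le_neg_iff, Real.log_rpow hN0, le_div_iff₀ hlogz]
  calc (1 : ℝ) / 16 * u * Real.log z ≤ (1 : ℝ) / 16 * u * (2 * Real.log N / u) :=
        mul_le_mul_of_nonneg_left hlogz2 (by positivity)
    _ = (1 : ℝ) / 8 * Real.log N := by field_simp; ring

/-- `1/log z ≤ u/log N` for `z > N^{1/u} > 1`. [folklore] -/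
theorem one_div_log_le {N u : ℕ} (hu : 1 ≤ u) (hN1 : (1 : ℝ) < (N : ℝ) ^ ((1 : ℝ) / u)) {z : ℝ}
    (hz : (N : ℝ) ^ ((1 : ℝ) / u) < z) : 1 / Real.log z ≤ (u : ℝ) / Real.log N := by
  have hu0 : (0 : ℝ) < u := by exact_mod_cast hu
  have hN0 : (0 : ℝ) < N := by
    by_contra h
    push Not at h
    have : (N : ℝ) = 0 := le_antisymm h (Nat.cast_nonneg N)
    rw [this, Real.zero_rpow (by positivity)] at hN1
    linarith
  have hlogy : Real.log ((N : ℝ) ^ ((1 : ℝ) / u)) = Real.log N / u := by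
    rw [Real.log_rpow hN0]; ring
  have hlogy0 : 0 < Real.log N / u := by rw [← hlogy]; exact Real.log_pos hN1
  have hlogN : 0 < Real.log N := by
    by_contra h; push Not at h
    have : Real.log N / u ≤ 0 := div_nonpos_of_nonpos_of_nonneg h hu0.le
    linarith
  have hlogz : Real.log N / u ≤ Real.log z := by
    rw [← hlogy]; exact Real.log_le_log (by positivity) hz.le
  rw [div_le_div_iff₀ (by linarith) hlogN, one_mul]
  calc Real.log N = (Real.log N / u) * u := by field_simp
    _ ≤ Real.log z * u := mul_le_mul_of_nonneg_right hlogz hu0.le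
    _ = u * Real.log z := mul_comm _ _

/-- **The sieve product against the singular product**: for a non-degenerate `Ψ` with `|a_k| ≤ L`,
`u ≥ 1`, `N^{1/u} > 1` and `z > N^{1/u}` with `⌈z⌉ − 1 ≥ max(L, 4t², 1)`,
`V(z) = ∏_{p<z}(1 − ω(p)/p) ≤ 2 ∏_p β_p · (w u/log N)^t` for any `w ≥ 1` with `1/log z ≤ w u /log N`
— here packaged with the hypothesis `1/log z ≤ W` directly. [cite: GreenTao2010, (1.6)–(1.7)] -/
theorem prod_one_sub_rootCount_le_main {Ψ : Fin t → AffLinForm 1} (hΨ : IsNondegenerateSystem Ψ)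
    {L : ℕ} (haL : ∀ k, ((Ψ k).coeff 0).natAbs ≤ L) {z W : ℝ} (hz1 : 1 < z)
    (hhead : L ≤ ⌈z⌉₊ - 1 ∧ 4 * t ^ 2 ≤ ⌈z⌉₊ - 1 ∧ 1 ≤ ⌈z⌉₊ - 1)
    (hW : 1 / Real.log z ≤ W) :
    ∏ p ∈ Nat.primesBelow ⌈z⌉₊, (1 - (polyRootCountMod ![sysPoly Ψ] p : ℝ) / p) ≤
      2 * singularProduct Ψ * W ^ t := by
  have h1 := prod_one_sub_rootCount_le Ψ hz1
  have h2 := singularProductPartial_le_two_mul_singularProduct hΨ haL hhead.1 hhead.2.1 hhead.2.2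
  have hlog0 : 0 ≤ 1 / Real.log z := by
    have := Real.log_pos hz1; positivity
  have hsp0 : 0 ≤ singularProductPartial Ψ (⌈z⌉₊ - 1) :=
    Finset.prod_nonneg fun p _ => localFactor_nonneg Ψ p
  calc _ ≤ singularProductPartial Ψ (⌈z⌉₊ - 1) * (1 / Real.log z) ^ t := h1
    _ ≤ (2 * singularProduct Ψ) * W ^ t :=
        mul_le_mul h2 (pow_le_pow_left₀ hlog0 hW t) (pow_nonneg hlog0 t) (by linarith)
    _ = 2 * singularProduct Ψ * W ^ t := by ring

/-! ### The arithmetic of the main term -/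

/-- The main term: `C #I V E ≤ 2 C R · (β_∞ ∏β_p) · W + C` when `#I ≤ β_∞ + 1`, `0 ≤ V ≤ 1`,
`V ≤ 2 (∏β_p) W`, `0 ≤ E ≤ 1`, `E ≤ R`. [folklore] -/
theorem main_term_le {C I AF SP V E W R : ℝ} (hC : 0 ≤ C) (hI : I ≤ AF + 1)
    (hAF : 0 ≤ AF) (hSP : 0 ≤ SP) (hW : 0 ≤ W) (hV0 : 0 ≤ V) (hV1 : V ≤ 1) (hV : V ≤ 2 * SP * W)
    (hE0 : 0 ≤ E) (hE1 : E ≤ 1) (hER : E ≤ R) :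
    C * I * V * E ≤ 2 * C * R * (AF * SP) * W + C := by
  have h1 : C * I * V * E ≤ C * (AF + 1) * V * E := by
    have := mul_le_mul_of_nonneg_left hI hC
    have hVE : 0 ≤ V * E := mul_nonneg hV0 hE0
    nlinarith
  have h2 : C * AF * V * E ≤ C * AF * (2 * SP * W) * R := by
    have hCA : 0 ≤ C * AF := mul_nonneg hC hAF
    calc C * AF * V * E ≤ C * AF * (2 * SP * W) * E := by
          have := mul_le_mul_of_nonneg_left hV hCA; nlinarith
      _ ≤ C * AF * (2 * SP * W) * R :=
          mul_le_mul_of_nonneg_left hER (by positivity)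
  have h3 : C * V * E ≤ C := by
    calc C * V * E ≤ C * 1 * 1 := by
          have := mul_le_mul hV1 hE1 hE0 zero_le_one
          nlinarith
      _ = C := by ring
  nlinarith

end Summit.Parity.GeneralizedHardyLittlewood.Theorems.AbsoluteUpgrade

end
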